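import Summits.QuantumFields.YangMills.Theorems.BalabanUVNodesN27AtRecord
import Summits.QuantumFields.YangMills.Theorems.BalabanUVNodesN20Knit
import Summits.QuantumFields.YangMills.Theorems.BalabanUVNodesN21AtSpineCarriers
import Summits.QuantumFields.YangMills.Theorems.BalabanUVNodesN19AtSpineCarriers

/-!
# BalabanUVNodes ∕ N27 = binder B5 AT THE RECORD, XV — THE NODE FROM ITS CHILDREN'S READING PREDICATES, BY NAME: what the spine-carrier
# record `SRec` must hand N20 (n20-a's extraction laws, `N20Knit.relWeightBound_of_extractionLaws`), N21 (n21-a's slot-ledger reading,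
# `N21AtSpineCarriers.s_N21_of_slotLedgersReading`) and N19 (n19-a's synchronised-ledger reading, `N19LedgerLinkSync.core_summable_of_ledgerAtSync`
# — PIN-FREE: no `deltaOfRecord`), together with the extraction stub `S_N27x` and K4's hook, gives `Spine Rec` (XII's `spine_of_coreEdge`)
# (cell `pub-ymgap`, HUMAN RULING D-0062 Track A, seat `pub-ymgap-dag-n27-a` g4; `--supports stmt-QuantumFields-19182`, count-neutral)

WHY.  File XII proved B5 at the record from the K5 stubs in the rev-1 shape: `spine_of_coreEdge : S_N27x Rec SRec → S_N20 SRec → S_N21 SRec → (∃δ-edge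
of N19) → SpineRates Rec Inputs → Spine Rec`.  Meanwhile each K5 child's seat has landed, over the same route module, the RECORD-LEVEL READING that
produces its stub from the tree's constructors: n21-a `s_N21_of_slotLedgersReading` (two `T4ShellMeasure.SlotLedger`s under one geometric majorant ⇒
`S_N21 SRec`), n19-a `s_N19_of_ledgerAtSyncReading` (a `LedgerAtSync` package + the in-edges BY NAME ⇒ `S_N19 SRec Inputs`, through the interim
`deltaOfRecord` pin), and n20-a's carrier-abstract `relWeightBound_of_extractionLaws` (two runs' `PinnedExtraction.ExtractionLaws` + the count ⇒
`RelWeightBound` at exact carriers; no `S_N20 SRec` face in the tree — n20-a closed without successor).  THIS FILE threads them: §1 the N20 reading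
face `s_N20_of_extractionLawsReading` (supplied from the consumer side, superseded-not-edited should an n20 seat file its own); §2 the N19 reading in
PIN-FREE form — the SAME `hread` package as n19-a's `s_N19_of_ledgerAtSyncReading`, concluding the ∃δ-edge directly (`core_summable_of_ledgerAtSync`),
so no `S.δ = deltaOfRecord …` clause is asked; §3 **`spine_of_readings`**: `S_N27x` · N20-reading · N21-reading · N19-reading · `SpineRates` ⇒ `Spine Rec`
— binder B5 at every record pair from exactly what the three children's seats say the record must hand them.

HONEST FRAMING.  COMPOSITE-node bookkeeping over PARAMETERS `Rec` ∕ `SRec` ∕ `Inputs`; every reading is a HYPOTHESIS SHAPE (extraction laws =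
[Balaban1989LargeFieldII] (1.79)–(1.89)'s KIND displayed, not proved; slot ledgers; the NODE O ledger with NE3 ∕ NE5 ∕ NE9 ∕ NE4-output ∕ (T) as
hypothesis shapes — none printed for the d = 4 procedure, none proved); no carrier of record exists in the tree; nothing of Bałaban's is instantiated
or asserted; NO node is discharged; typed 28∕28, discharged count untouched; one finite four-torus programme — NOT ℝ⁴, NOT infinite volume, NOT OS,
NOT a mass gap, NOT Clay.  Restate-immune (neither the Theses file nor g0's module imported).  No decl below carries a cite tag.
-/

open Finset MeasureTheory

namespace Summit.QuantumFields.YangMills.Theorems.BalabanUVNodesN27SpineRecord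

open Literature.MathematicalPhysics.QuantumFieldTheory.Balaban1983to89
open Literature.MathematicalPhysics.QuantumFieldTheory.Balaban1983to89.T4Continuum
open T4OutputRate T4RecentScale T4GoodClassBudget T4CauchySum T4TowerRateComposition T4TowerRateDischarge
open T4WeightBudget (RelWeightBound)
open T4IndicatorShell (ShellWeightBound)
open T4EtaRateMin (Readings NE3Shape)
open T4RateLiaison (GaugeDominated)
open T4ShellMeasure (SlotLedger)
open Summit.QuantumFields.BalabanUV.T4Continuum.Spine
open Summit.QuantumFields.BalabanUV.T4Continuum.NE7b.PinnedExtraction (ExtractionLaws)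
open Summit.QuantumFields.YangMills.BalabanUVNodes.N20Knit (relWeightBound_of_extractionLaws)
open Summit.QuantumFields.YangMills.BalabanUVNodes.N19LedgerLinkSync (LedgerDataSync LedgerAtSync core_summable_of_ledgerAtSync)
open Summit.QuantumFields.YangMills.Theorems.N21AtSpineCarriers (s_N21_of_slotLedgersReading)
open YMDAG.UVSplit

section Readings

variable {N : ℕ} [NeZero N]

/-! ## §1 The N20 reading face at the spine carriers (n20-a's `relWeightBound_of_extractionLaws` BY NAME) -/

/-- **`S_N20 SRec` FOR EVERY EXTRACTION-LAWS READING.**  If the spine-carrier predicate `SRec` hands, with every bundle `S` it pins, the two runs'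
`PinnedExtraction.ExtractionLaws` over `S.T`, `S.Bad` (pinned classes `X ∕ X′`, sub-classes `Badx ∕ Badx′`, source-uniform quotients `q ∕ q′` — the
H3^NE7b display of (1.79)–(1.89)'s KIND, relative to the same run's full sum), nonnegative weights `S.A`, `S.B`, quotient totals `≤ S.W K` in both runs,
`S.W K < 1` for every `K` and `Summable S.W`, then `S_N20 SRec` — n20-a's `N20Knit.relWeightBound_of_extractionLaws` at the bundle's exact carriers.
(The consumer-side N20 reading face; what a record predicate must supply for N20.) [bookkeeping] [folklore] -/
theorem s_N20_of_extractionLawsReading (SRec : SpineRecordPred N)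
    (hread : ∀ (F : T4Family) (D : Datum F N) (g₀ : ℕ → ℝ) (os : List (ULoop F)) (S : SpineCarriers), SRec F D g₀ os S →
      ∃ (α α' : Type) (X : ℕ → Finset α) (Badx : ℕ → α → Finset S.ι) (q : ℕ → α → ℝ)
        (X' : ℕ → Finset α') (Badx' : ℕ → α' → Finset S.ι) (q' : ℕ → α' → ℝ),
        ExtractionLaws S.l₀ S.T S.A S.Bad X Badx q ∧ ExtractionLaws S.l₀ S.T S.B S.Bad X' Badx' q' ∧
        (∀ (K : ℕ) (t : ℝ), |t| ≤ S.l₀ → ∀ τ, 0 ≤ S.A K t τ) ∧ (∀ (K : ℕ) (t : ℝ), |t| ≤ S.l₀ → ∀ τ, 0 ≤ S.B K t τ) ∧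
        (∀ K, ∑ x ∈ X K, q K x ≤ S.W K) ∧ (∀ K, ∑ x ∈ X' K, q' K x ≤ S.W K) ∧ (∀ K, S.W K < 1) ∧ Summable S.W) :
    S_N20 SRec := by
  intro F D g₀ os S hS
  obtain ⟨α, α', X, Badx, q, X', Badx', q', hA, hB, hA0, hB0, hWA, hWB, h1, hs⟩ := hread F D g₀ os S hS
  exact relWeightBound_of_extractionLaws hA hB hA0 hB0 hWA hWB h1 hs

/-! ## §2 The N19 reading, PIN-FREE: n19-a's `LedgerAtSync` package ⇒ the ∃δ-edge (no `deltaOfRecord` clause) -/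

/-- **THE ∃δ-EDGE OF N19 FROM THE SYNCHRONISED-LEDGER READING, NO δ-PIN.**  The hypothesis is n19-a's `s_N19_of_ledgerAtSyncReading` READING
VERBATIM — with every bundle `S` and K4's conclusion, `SRec ∧ Inputs` hand rate carriers `C`, a reading family `R`, ledger data `L` with
`LedgerAtSync L S.l₀ S.vol S.T S.Bad (A − shA) (B − shB) R EA EB κ g uA uB ω θc θ₅ θ₃` and the in-edges BY NAME (N16 `NE3Shape` + `GaugeDominated`, N18 `NE5`,
N22 `NE9 ∧ FadingMemory`, N17 via node U2's `InjectedRate`, (T) `LipBackground` + `PolyLipGrowth`, window memberships) — and the conclusion is the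
∃δ-edge «some summable `δ` carries `Spine.NE7.Core` on the shell-free cores» (`core_summable_of_ledgerAtSync` BY NAME), i.e. XII's `spine_of_coreEdge`
input: the interim pin `S.δ = deltaOfRecord …` of n19-a's junction is NOT asked. [bookkeeping] [folklore] -/
theorem coreEdge_of_ledgerAtSyncReading (SRec : SpineRecordPred N) (Inputs : InputsPred N)
    (hread : ∀ (F : T4Family) (D : Datum F N) (g₀ : ℕ → ℝ) (os : List (ULoop F)) (S : SpineCarriers),
      SRec F D g₀ os S → Inputs F D g₀ os → letI := S.dec
      ∃ (C : Carriers) (_ : DecidableEq C.Dom) (F' : Type) (ι' X' : Type) (_ : MeasurableSpace ι')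
        (L : LedgerDataSync C F' ι' S.ι) (R : Readings ι' X') (W : Set (ℕ → ℝ)) (EA : Functional C C.BgA)
        (EB : Functional C C.BgB) (κ θ₅ C₅ C₉ ω θc Cd γ C₃ θ₃ Pg : ℝ) (q : ℕ) (Λm : ℕ → ℕ → ℝ)
        (CU : (ℕ → ℝ) → ℕ → ℝ) (g : ℕ → ℕ → ℝ) (uA : ℕ → ι' → C.BgA) (uB : ℕ → ι' → C.BgB),
        LedgerAtSync L S.l₀ S.vol S.T S.Bad (fun K t τ => S.A K t τ - S.shA K t τ) (fun K t τ => S.B K t τ - S.shB K t τ)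
          R EA EB κ g uA uB ω θc θ₅ θ₃ ∧
        NE3Shape R C₃ θ₃ ∧ 0 ≤ C₃ ∧ GaugeDominated R uA uB ∧
        NE5 EA EB W κ θ₅ C₅ ∧ 0 ≤ θ₅ ∧ 0 ≤ C₅ ∧
        (NE9 EA W κ Λm ∧ T4OutputRate.FadingMemory C₉ ω Λm) ∧ 0 ≤ ω ∧
        InjectedRate Cd 0 θc (fun K j => T4CouplingMatching.disc (g K) (g (K + 1)) j) ∧ 0 ≤ Cd ∧ 0 ≤ θc ∧
        (∀ K i, i ≤ K → 0 < g K i ∧ g K i ≤ γ) ∧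
        LipBackground EA W κ CU ∧ PolyLipGrowth CU g Pg q ∧ 0 ≤ Pg ∧
        (∀ K, g K ∈ W) ∧ (∀ K, (fun i => g (K + 1) (i + 1)) ∈ W))
    (F : T4Family) (D : Datum F N) (g₀ : ℕ → ℝ) (os : List (ULoop F)) (S : SpineCarriers)
    (hS : SRec F D g₀ os S) (hI : Inputs F D g₀ os) : letI := S.dec
      ∃ δ : ℕ → ℝ, NE7.Core S.l₀ S.vol S.T S.Bad (fun K t τ => S.A K t τ - S.shA K t τ) (fun K t τ => S.B K t τ - S.shB K t τ) δ ∧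
        Summable δ := by
  letI := S.dec
  obtain ⟨C, _, F', ι', X', _, L, R, W, EA, EB, κ, θ₅, C₅, C₉, ω, θc, Cd, γ, C₃, θ₃, Pg, q, Λm, CU, g, uA, uB, hL, h16, hC₃,
    hgd, h18, hθ₅, hC₅, h22, hω, hinj, hCd, hθc, hbox, hU, hG, hPg, hgA, hgB⟩ := hread F D g₀ os S hS hI
  exact core_summable_of_ledgerAtSync hL h16 hC₃ hgd h18 hθ₅ hC₅ h22 hω hinj hCd hθc hbox hU hG hPg hgA hgB

end Readings

/-! ## §3 B5 at the record from the three children's READINGS, the extraction stub and K4's hook -/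

section Spine

variable {N : ℕ} [NeZero N] (Rec : RecordPred N) (SRec : SpineRecordPred N) (Inputs : InputsPred N)

/-- **N27 = B5 AT THE RECORD FROM THE CHILDREN'S READING PREDICATES.**  For EVERY record predicate `Rec`, spine-carrier predicate `SRec` and K4
hook `Inputs`: the extraction stub `S_N27x Rec SRec` (the expansion of record exists under the pins, E1∕E2), the N20 READING (two runs' extraction
laws + the count at the bundle's carriers, §1), the N21 READING (n21-a: two slot ledgers under one geometric majorant, `S.Wsh` summable and dominating),
the N19 READING (n19-a: the `LedgerAtSync` package with the in-edges N16 ∕ N17 ∕ N18 ∕ N22 ∕ (T) BY NAME, §2 — PIN-FREE) and K4's conclusion hook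
`SpineRates Rec Inputs` give `Spine Rec` — `T4ApexHybrid.HybridNE7Under D END` at every record pair — by XII's `spine_of_coreEdge` over
`s_N20_of_extractionLawsReading`, `N21AtSpineCarriers.s_N21_of_slotLedgersReading`, `coreEdge_of_ledgerAtSyncReading`.  Every hypothesis is what
the respective child's seat states the record must hand it; nothing else enters. [bookkeeping] [folklore] -/
theorem spine_of_readings (hx : S_N27x Rec SRec)
    (hread20 : ∀ (F : T4Family) (D : Datum F N) (g₀ : ℕ → ℝ) (os : List (ULoop F)) (S : SpineCarriers), SRec F D g₀ os S →
      ∃ (α α' : Type) (X : ℕ → Finset α) (Badx : ℕ → α → Finset S.ι) (q : ℕ → α → ℝ)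
        (X' : ℕ → Finset α') (Badx' : ℕ → α' → Finset S.ι) (q' : ℕ → α' → ℝ),
        ExtractionLaws S.l₀ S.T S.A S.Bad X Badx q ∧ ExtractionLaws S.l₀ S.T S.B S.Bad X' Badx' q' ∧
        (∀ (K : ℕ) (t : ℝ), |t| ≤ S.l₀ → ∀ τ, 0 ≤ S.A K t τ) ∧ (∀ (K : ℕ) (t : ℝ), |t| ≤ S.l₀ → ∀ τ, 0 ≤ S.B K t τ) ∧
        (∀ K, ∑ x ∈ X K, q K x ≤ S.W K) ∧ (∀ K, ∑ x ∈ X' K, q' K x ≤ S.W K) ∧ (∀ K, S.W K < 1) ∧ Summable S.W)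
    (hread21 : ∀ (F : T4Family) (D : Datum F N) (g₀ : ℕ → ℝ) (os : List (ULoop F)) (S : SpineCarriers), SRec F D g₀ os S →
      ∃ (σA σB : Type) (SA : ℕ → Finset σA) (SB : ℕ → Finset σB) (pieceA : ℕ → ℝ → σA → S.ι → ℝ)
        (pieceB : ℕ → ℝ → σB → S.ι → ℝ) (cA : ℕ → σA → ℝ) (cB : ℕ → σB → ℝ) (C ϑ : ℝ),
        SlotLedger S.l₀ S.T S.A S.shA SA pieceA cA ∧ SlotLedger S.l₀ S.T S.B S.shB SB pieceB cB ∧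
        0 ≤ ϑ ∧ ϑ < 1 ∧ (∀ K, ∑ s ∈ SA K, cA K s ≤ C * ϑ ^ K) ∧ (∀ K, ∑ s ∈ SB K, cB K s ≤ C * ϑ ^ K) ∧
        (∀ K, ∑ s ∈ SA K, cA K s + ∑ s ∈ SB K, cB K s ≤ S.Wsh K) ∧ Summable S.Wsh)
    (hread19 : ∀ (F : T4Family) (D : Datum F N) (g₀ : ℕ → ℝ) (os : List (ULoop F)) (S : SpineCarriers),
      SRec F D g₀ os S → Inputs F D g₀ os → letI := S.dec
      ∃ (C : Carriers) (_ : DecidableEq C.Dom) (F' : Type) (ι' X' : Type) (_ : MeasurableSpace ι')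
        (L : LedgerDataSync C F' ι' S.ι) (R : Readings ι' X') (W : Set (ℕ → ℝ)) (EA : Functional C C.BgA)
        (EB : Functional C C.BgB) (κ θ₅ C₅ C₉ ω θc Cd γ C₃ θ₃ Pg : ℝ) (q : ℕ) (Λm : ℕ → ℕ → ℝ)
        (CU : (ℕ → ℝ) → ℕ → ℝ) (g : ℕ → ℕ → ℝ) (uA : ℕ → ι' → C.BgA) (uB : ℕ → ι' → C.BgB),
        LedgerAtSync L S.l₀ S.vol S.T S.Bad (fun K t τ => S.A K t τ - S.shA K t τ) (fun K t τ => S.B K t τ - S.shB K t τ)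
          R EA EB κ g uA uB ω θc θ₅ θ₃ ∧
        NE3Shape R C₃ θ₃ ∧ 0 ≤ C₃ ∧ GaugeDominated R uA uB ∧
        NE5 EA EB W κ θ₅ C₅ ∧ 0 ≤ θ₅ ∧ 0 ≤ C₅ ∧
        (NE9 EA W κ Λm ∧ T4OutputRate.FadingMemory C₉ ω Λm) ∧ 0 ≤ ω ∧
        InjectedRate Cd 0 θc (fun K j => T4CouplingMatching.disc (g K) (g (K + 1)) j) ∧ 0 ≤ Cd ∧ 0 ≤ θc ∧
        (∀ K i, i ≤ K → 0 < g K i ∧ g K i ≤ γ) ∧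
        LipBackground EA W κ CU ∧ PolyLipGrowth CU g Pg q ∧ 0 ≤ Pg ∧
        (∀ K, g K ∈ W) ∧ (∀ K, (fun i => g (K + 1) (i + 1)) ∈ W))
    (h4 : SpineRates Rec Inputs) : Spine Rec :=
  spine_of_coreEdge Rec SRec Inputs hx (s_N20_of_extractionLawsReading SRec hread20) (s_N21_of_slotLedgersReading SRec hread21)
    (coreEdge_of_ledgerAtSyncReading SRec Inputs hread19) h4

end Spine

end Summit.QuantumFields.YangMills.Theorems.BalabanUVNodesN27SpineRecord
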